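import Summits.ResolutionOfSingularities.ResolutionOfSingularities.Theorems.KaplanskyDefectlessType
import HarnessLib

/-!
# KaplanskyDefectless — Kaplansky's theorem over a rank-one defectless base, without pseudo-convergent sequences
(PROVED), file 2/2

PROVED valuation theory (no ports, no named facts; summit-free mathematics, homed under `Summits/…/Theorems`
because the gate's Literature lint admits only
PUBLISHED statements with per-declaration cite tags and this ARGUMENT is new — dry-run 2026-08-30T22:5xZ; the
critic's plan item (K) named Literature/): Kaplansky's
/-- `«no`: Auxiliary step of this node's calculus, VERBATIM from the lens file (see the module docstring); the
statement is its type. [folklore] -/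
theorem «no algebraic pseudo-limits over a rank-one DEFECTLESS base» WITHOUT pseudo-convergent sequences —
root-wise eventual constancy of values
+ a Hasse–Taylor good-radius estimate show that an algebraic pseudo-limit of degree `d ≥ 2` over the
henselization `F^h` would generate a proper
IMMEDIATE finite extension of `F^h`, killed by henselian + defectless (Kuhlmann 2010 Thm 2.14, tree
`HenselizationDefectless`) with NO separability
hypothesis; degree 1 by rank-one density (Kuhlmann 2010 Lemma 2.4, tree `HenselizationDensity`).  It is the
INSEPARABLE-capable companion of the
tree's `KnafKuhlmann2009Lemma216` (`kaplansky_condition_of_isSepClosed`, whose helpers `exists_valuation_sub_lt`,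
`coeff_hasseDeriv_mem` are reused)
and of `Kuhlmann2019HenselianRationalityLemmas` (twins `relfinrank_eq_relIndex_mul_relfinrank_of_isDefectlessField`,
`eq_of_isDefectlessField_of_immediate`).
Content VERBATIM from the decomp-res lens-1 g19 rev 1 TREE-FACING COMPANION
`HOME/decomp-res-lens-1/g19/tree/DefectlessLadderTree.lean` (sha256
45a9879c65cfd008…, §25 A–C = l. 946–1566; node `g19/DefectlessLadder.lean` bf11eb22…, CRITIC-LEDGER row
145; landing plan item (K) of the lens's
WRITER.md, endorsed by decomp-res-crit-1 g5 2026-08-30T21:39:44Z), namespace `…Theorems.DefectlessLadder` as in the companion;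
the near-duplicate `eval_mem_subfield_of_coeff_mem` is NOT re-landed — its two uses
cite the tree's `AbhyankarEtaleAscent.eval_mem_of_coeff_mem` (critic).  HOME = run/shared/lean/pub/decomp-res.  Used by
`Theorems/DefectlessLadder` to PROVE the decomp-res bridge `KaplanskyLadder.TratOfDefectlessBase`; landed as SUPPORT
(helper) of Valuative 0641.

§25-C · `not_isPseudoLimit_of_isIntegral` (no element algebraic over the henselization `F^h` is a pseudo-limit of
`z` over a rank-one
defectless `F` with `F(z)|F` immediate at bounded distance — induction on the degree over `F^h`) and
`kaplansky_condition_of_isDefectlessField`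
(Kaplansky's condition (3) for such `F`).  PROVED, 0 sorry.

(Sources: Kaplansky1942 (Duke Math. J. 9) Lemma 5, Thm 3; Kuhlmann2010 arXiv:1003.5678 Lemma 2.4, Thm 2.14; Kuhlmann
arXiv:1004.2135 Thm 3; KnafKuhlmann2009 arXiv:math/0702856 Lemma 2.16.)
-/

noncomputable section

open IsLocalRing Literature.AlgebraicGeometry.Resolution
open Polynomial

universe u

namespace Summit.ResolutionOfSingularities.ResolutionOfSingularities.Theorems.DefectlessLadder

/-! ### Kaplansky's theorem: no algebraic pseudo-limits over a rank-one defectless base -/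

section Main

variable {Ω : Type u} [Field Ω] [IsAlgClosed Ω] {V : ValuationSubring Ω} {F : Subfield Ω}

/-- **No algebraic pseudo-limits.** Let `(F, V ∩ F)` be of rank one and defectless, `z ∉ F` with
`F(z)|F` immediate and at bounded distance from `F`. Then no element of `Ω` algebraic over the
henselization `F^h` is a pseudo-limit of `z` over `F`. Induction on the degree `d` over `F^h`:
`d = 1` contradicts the density of `F` in `F^h` (rank one); for `d ≥ 2` every non-zero
polynomial over `F^h` of degree `< d` has eventually constant value near `z` (its roots are no
pseudo-limits), and the Hasse–Taylor expansion then shows that `F^h(θ)|F^h` is IMMEDIATE of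
degree `d` — impossible over the henselian defectless `F^h`. [folklore] -/
theorem not_isPseudoLimit_of_isIntegral (hr1 : IsRankOneValued V F)
    (hdef : IsDefectlessField F (V.comap (algebraMap F Ω))) {z : Ω} (hzF : z ∉ F)
    (hval : ∀ w ∈ Subfield.closure ((F : Set Ω) ∪ {z}), w ≠ 0 → ∃ b ∈ F,
      V.valuation w = V.valuation b)
    (hres : ∀ w ∈ Subfield.closure ((F : Set Ω) ∪ {z}), w ∈ V → ∃ c ∈ F,
      V.valuation (w - c) < 1)
    (hbd : ∃ b ∈ F, b ≠ 0 ∧ ∀ a ∈ F, V.valuation b ≤ V.valuation (z - a))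
    {θ : Ω} (hθ : IsIntegral (henselization V F) θ) : ¬ IsPseudoLimit V F z θ := by
  classical
  set Fh := henselization V F with hFh
  have hFFh : F ≤ Fh := le_henselization V F
  have hhens : IsHenselianField Fh (V.comap (algebraMap Fh Ω)) :=
    Kuhlmann2010HenselizationIsHenselian_holds Ω V F
  have hdefh : IsDefectlessField Fh (V.comap (algebraMap Fh Ω)) :=
    (Kuhlmann2010DefectlessIffHenselization_holds Ω V F).mp hdef
  have hza : ∀ a ∈ F, z - a ≠ 0 := fun a ha h => hzF (by rw [sub_eq_zero.mp h]; exact ha)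
  suffices H : ∀ n : ℕ, ∀ θ : Ω, IsIntegral Fh θ → (minpoly Fh θ).natDegree ≤ n →
      ¬ IsPseudoLimit V F z θ from H _ θ hθ le_rfl
  intro n
  induction n with
  | zero =>
    intro θ hθi hdeg hPL
    exact absurd hdeg (not_le.mpr (minpoly.natDegree_pos hθi))
  | succ n ih =>
    intro θ hθi hdeg hPL
    rcases Nat.lt_or_ge ((minpoly Fh θ).natDegree) (n + 1) with hlt | hge
    · exact ih θ hθi (Nat.lt_succ_iff.mp hlt) hPL
    have hdeg' : (minpoly Fh θ).natDegree = n + 1 := le_antisymm hdeg hge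
    -- every non-zero polynomial over `Fh` of degree `≤ n` has eventually constant value near `z`
    have hEC : ∀ h : Polynomial Ω, h ≠ 0 → (∀ i, h.coeff i ∈ Fh) → h.natDegree ≤ n →
        EvConst V F z h := by
      intro h h0 hcoef hdegh
      refine evConst_of_roots hzF hval hres h0 fun θ' hθ' => ?_
      obtain ⟨hθ'i, hdegθ'⟩ := isIntegral_of_mem_roots_of_coeff_mem hcoef h0 hθ'
      exact ih θ' hθ'i (hdegθ'.trans hdegh)
    rcases Nat.eq_zero_or_pos n with hn0 | hnpos
    · -- DEGREE ONE: `θ ∈ Fh`, and `F` is dense in `Fh` — contradiction with bounded distance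
      subst hn0
      have hθFh : θ ∈ Fh := by
        have h1 : (minpoly Fh θ).degree = 1 := by
          rw [degree_eq_natDegree (minpoly.ne_zero hθi), hdeg']
          rfl
        obtain ⟨c, hc⟩ := minpoly.mem_range_of_degree_eq_one Fh θ h1
        rw [← hc]
        exact c.2
      obtain ⟨b, hbF, hb0, hb⟩ := hbd
      obtain ⟨π, hπF, hπ1⟩ := hr1.1
      have hπ0 : π ≠ 0 := fun h => ne_zero_of_lt hπ1 (by rw [h, map_zero])
      have hπ : ∃ π ∈ F, π ≠ 0 ∧ V.valuation π < 1 :=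
        ⟨π⁻¹, F.inv_mem hπF, inv_ne_zero hπ0, by rw [map_inv₀]; exact inv_lt_one_of_one_lt₀ hπ1⟩
      obtain ⟨c, hcF, hlt⟩ := exists_mem_valuation_sub_lt_of_mem_henselization_of_archimedean V F
        (fun y w hy hw h1 => hr1.archimedean_of_isAlgebraic hy hw h1) hπ hθFh
        (isAlgebraic_algebraMap (⟨b, hbF⟩ : F)) hb0
      have h1 : V.valuation (z - θ) < V.valuation (z - c) := hPL c hcF
      have h2 : V.valuation (θ - c) < V.valuation (z - c) := lt_of_lt_of_le hlt (hb c hcF)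
      have h3 : V.valuation (z - c) ≤ max (V.valuation (z - θ)) (V.valuation (θ - c)) := by
        have : z - c = (z - θ) + (θ - c) := by ring
        rw [this]
        exact Valuation.map_add _ _ _
      rcases le_max_iff.mp h3 with h | h
      · exact absurd h (not_le.mpr h1)
      · exact absurd h (not_le.mpr h2)
    · -- DEGREE ≥ 2: `Fh(θ) | Fh` is an immediate extension of degree `n + 1 ≥ 2`
      -- (A) the key estimate: `v(h(θ) - h(a)) < v(h(a))` for some `a ∈ F`
      have hkey : ∀ h : Polynomial Ω, h ≠ 0 → (∀ i, h.coeff i ∈ Fh) → h.natDegree ≤ n →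
          ∃ a ∈ F, V.valuation (h.eval θ - h.eval a) < V.valuation (h.eval a) := by
        intro h h0 hcoef hdegh
        -- constant polynomials
        by_cases hN0 : h.natDegree = 0
        · obtain ⟨c₀, hc₀⟩ : ∃ c₀, h = C c₀ := ⟨_, eq_C_of_natDegree_eq_zero hN0⟩
          refine ⟨0, F.zero_mem, ?_⟩
          rw [hc₀, eval_C, eval_C, sub_self, map_zero]
          exact (Valuation.pos_iff _).mpr fun hc => h0 (by rw [hc₀, hc, C_0])
        set N := h.natDegree with hN
        have hNpos : 0 < N := Nat.pos_of_ne_zero hN0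
        -- eventually-constant data for the Hasse derivatives
        have hDcoef : ∀ j i, (hasseDeriv j h).coeff i ∈ Fh := fun j i =>
          coeff_hasseDeriv_mem Fh hcoef j i
        have hDdeg : ∀ j, (hasseDeriv j h).natDegree ≤ n := fun j =>
          (natDegree_hasseDeriv_le h j).trans ((Nat.sub_le _ _).trans hdegh)
        have hdata : ∀ j : ℕ, ∃ c : Ω, ∃ β : V.ValueGroup, hasseDeriv j h ≠ 0 →
            (c ∈ F ∧ β ≠ 0 ∧ ∀ a ∈ F, V.valuation (z - a) ≤ V.valuation (z - c) →
              V.valuation ((hasseDeriv j h).eval a) = β) := by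
          intro j
          by_cases hj : hasseDeriv j h = 0
          · exact ⟨0, 1, fun h' => absurd hj h'⟩
          · obtain ⟨c, hc, β, hβ, hball⟩ := hEC _ hj (hDcoef j) (hDdeg j)
            exact ⟨c, β, fun _ => ⟨hc, hβ, hball⟩⟩
        choose c β hcβ using hdata
        -- the indices of the non-zero Hasse derivatives
        set J : Finset ℕ := (Finset.range (N + 1)).filter (fun j => hasseDeriv j h ≠ 0) with hJ
        have hJmem : ∀ {j}, j ∈ J ↔ j ≤ N ∧ hasseDeriv j h ≠ 0 := by
          intro j
          rw [hJ, Finset.mem_filter, Finset.mem_range, Nat.lt_succ_iff]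
        have h0J : 0 ∈ J := hJmem.mpr ⟨Nat.zero_le _, by rw [hasseDeriv_zero']; exact h0⟩
        have hNJ : N ∈ J := by
          refine hJmem.mpr ⟨le_rfl, fun hzero => ?_⟩
          have hc0 := congrArg (fun p : Polynomial Ω => p.coeff 0) hzero
          simp only [hasseDeriv_coeff, zero_add, Nat.choose_self, Nat.cast_one, one_mul,
            coeff_zero] at hc0
          exact h0 (leadingCoeff_eq_zero.mp hc0)
        -- a common centre `a₁`
        obtain ⟨j₀, hj₀J, hj₀⟩ :=
          Finset.exists_min_image J (fun j => V.valuation (z - c j)) ⟨0, h0J⟩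
        have ha₁F : c j₀ ∈ F := (hcβ j₀ (hJmem.mp hj₀J).2).1
        set a₁ := c j₀ with ha₁
        have hball : ∀ j ∈ J, ∀ a ∈ F, V.valuation (z - a) ≤ V.valuation (z - a₁) →
            V.valuation ((hasseDeriv j h).eval a) = β j := fun j hj a ha hle =>
          (hcβ j (hJmem.mp hj).2).2.2 a ha (hle.trans (hj₀ j hj))
        have hβ0 : ∀ j ∈ J, β j ≠ 0 := fun j hj => (hcβ j (hJmem.mp hj).2).2.1
        -- the finitely many bad radii
        obtain ⟨S, hS⟩ : ∃ S : Finset V.ValueGroup, ∀ r : V.ValueGroup, r ≠ 0 → r ∉ S →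
            ∀ i ∈ J, ∀ j ∈ J, i ≠ j → β i * r ^ i ≠ β j * r ^ j := by
          let ρ : ℕ × ℕ → V.ValueGroup := fun p =>
            if hex : ∃ r : V.ValueGroup, r ≠ 0 ∧ β p.1 * r ^ p.1 = β p.2 * r ^ p.2
            then hex.choose else 0
          refine ⟨(J ×ˢ J).image ρ, fun r hr hrS i hi j hj hij heq => hrS ?_⟩
          have hex : ∃ r : V.ValueGroup, r ≠ 0 ∧ β i * r ^ i = β j * r ^ j := ⟨r, hr, heq⟩
          have hρ : ρ (i, j) = hex.choose := dif_pos hex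
          have h1 := hex.choose_spec
          have : r = ρ (i, j) := by
            rw [hρ]
            exact valuation_radius_unique (hβ0 i hi) (hβ0 j hj) hr h1.1 hij heq h1.2
          rw [this]
          exact Finset.mem_image_of_mem ρ (Finset.mk_mem_product hi hj)
        -- a good radius `r₂ = v(z - a₂)` below `a₁`, and a closer `a₃`
        obtain ⟨a₂, ha₂F, h₂₁, havoid⟩ := exists_ball_avoid hzF hval hres S ha₁F
        obtain ⟨a₃, ha₃F, h₃₂⟩ := exists_valuation_sub_lt V F hzF hval hres ha₂F
        set r₂ := V.valuation (z - a₂) with hr₂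
        set r₃ := V.valuation (z - a₃) with hr₃
        have hr₂0 : r₂ ≠ 0 := (_root_.map_ne_zero _).mpr (hza a₂ ha₂F)
        have hr₃0 : r₃ ≠ 0 := (_root_.map_ne_zero _).mpr (hza a₃ ha₃F)
        have hr₂S : r₂ ∉ S := havoid a₂ ha₂F le_rfl
        have h₃₁ : V.valuation (z - a₃) ≤ V.valuation (z - a₁) := h₃₂.le.trans h₂₁
        -- values of the Taylor terms
        have hva₃₂ : V.valuation (a₃ - a₂) = r₂ := by
          have : a₃ - a₂ = (z - a₂) - (z - a₃) := by ring
          rw [this]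
          exact Valuation.map_sub_eq_of_lt_left _ h₃₂
        have hvθ₃ : V.valuation (θ - a₃) = r₃ := hPL.valuation_sub ha₃F
        -- the dominant index for radius `r₂`
        set J' : Finset ℕ := (Finset.range N).filter (fun i => hasseDeriv (i + 1) h ≠ 0) with hJ'
        have hJ'mem : ∀ {i}, i ∈ J' ↔ i < N ∧ hasseDeriv (i + 1) h ≠ 0 := by
          intro i
          rw [hJ', Finset.mem_filter, Finset.mem_range]
        have hJ'J : ∀ {i}, i ∈ J' → i + 1 ∈ J := fun hi =>
          hJmem.mpr ⟨Nat.succ_le_of_lt (hJ'mem.mp hi).1, (hJ'mem.mp hi).2⟩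
        have hN1 : N - 1 + 1 = N := by omega
        have hJ'ne : J'.Nonempty := ⟨N - 1, hJ'mem.mpr ⟨Nat.sub_lt hNpos one_pos, by
          rw [hN1]; exact (hJmem.mp hNJ).2⟩⟩
        obtain ⟨i₀, hi₀J', hi₀⟩ :=
          Finset.exists_max_image J' (fun i => β (i + 1) * r₂ ^ (i + 1)) hJ'ne
        set M := β (i₀ + 1) * r₂ ^ (i₀ + 1) with hM
        have hM0 : M ≠ 0 := mul_ne_zero (hβ0 _ (hJ'J hi₀J')) (pow_ne_zero _ hr₂0)
        -- (E) `v(h(a₃) - h(a₂)) = M`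
        have hE : V.valuation (h.eval a₃ - h.eval a₂) = M := by
          rw [eval_sub_eval_eq_sum h a₃ a₂]
          have hterm : ∀ i ∈ Finset.range N, i ∈ J' →
              V.valuation ((hasseDeriv (i + 1) h).eval a₂ * (a₃ - a₂) ^ (i + 1)) =
                β (i + 1) * r₂ ^ (i + 1) := by
            intro i _ hi
            rw [map_mul, map_pow, hva₃₂, hball _ (hJ'J hi) a₂ ha₂F h₂₁]
          rw [hM, ← hterm i₀ (Finset.mem_of_mem_filter i₀ hi₀J') hi₀J']
          refine Valuation.map_sum_eq_of_lt _ (Finset.mem_of_mem_filter i₀ hi₀J') fun i hi => ?_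
          rw [Finset.mem_sdiff, Finset.mem_singleton] at hi
          rw [hterm i₀ (Finset.mem_of_mem_filter i₀ hi₀J') hi₀J']
          by_cases hiJ' : i ∈ J'
          · rw [hterm i hi.1 hiJ']
            refine lt_of_le_of_ne (hi₀ i hiJ') ?_
            have hne : i + 1 ≠ i₀ + 1 := fun h => hi.2 (Nat.succ_injective h)
            exact hS r₂ hr₂0 hr₂S _ (hJ'J hiJ') _ (hJ'J hi₀J') hne
          · have hz : hasseDeriv (i + 1) h = 0 := by
              by_contra hne
              exact hiJ' (hJ'mem.mpr ⟨Finset.mem_range.mp hi.1, hne⟩)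
            rw [hz, eval_zero, zero_mul, map_zero]
            exact zero_lt_iff.mpr hM0
        -- (V) `M ≤ β 0 = v(h(a₂)) = v(h(a₃))`
        have hv₂ : V.valuation (h.eval a₂) = β 0 := by
          have := hball 0 h0J a₂ ha₂F h₂₁
          rwa [hasseDeriv_zero'] at this
        have hv₃ : V.valuation (h.eval a₃) = β 0 := by
          have := hball 0 h0J a₃ ha₃F h₃₁
          rwa [hasseDeriv_zero'] at this
        have hMle : M ≤ β 0 := by
          rw [← hE]
          refine (Valuation.map_sub _ _ _).trans ?_
          rw [hv₃, hv₂, max_self]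
        -- (U) `v(h(θ) - h(a₃)) < M`
        have hU : V.valuation (h.eval θ - h.eval a₃) < M := by
          rw [eval_sub_eval_eq_sum h θ a₃]
          refine Valuation.map_sum_lt _ hM0 fun i hi => ?_
          by_cases hiJ' : i ∈ J'
          · rw [map_mul, map_pow, hvθ₃, hball _ (hJ'J hiJ') a₃ ha₃F h₃₁]
            calc β (i + 1) * r₃ ^ (i + 1) < β (i + 1) * r₂ ^ (i + 1) :=
                  mul_lt_mul_of_pos_left (pow_lt_pow_left₀ h₃₂ zero_le (Nat.succ_ne_zero i))
                    (zero_lt_iff.mpr (hβ0 _ (hJ'J hiJ')))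
              _ ≤ M := hi₀ i hiJ'
          · have hz : hasseDeriv (i + 1) h = 0 := by
              by_contra hne
              exact hiJ' (hJ'mem.mpr ⟨Finset.mem_range.mp hi, hne⟩)
            rw [hz, eval_zero, zero_mul, map_zero]
            exact zero_lt_iff.mpr hM0
        refine ⟨a₃, ha₃F, ?_⟩
        rw [hv₃]
        exact lt_of_lt_of_le hU hMle
      -- (B) the subfield `E = Fh(θ)` and its elements
      set E : Subfield Ω := (IntermediateField.adjoin Fh ({θ} : Set Ω)).toSubfield with hE
      have hFhE : Fh ≤ E := fun x hx =>
        (IntermediateField.adjoin Fh ({θ} : Set Ω)).algebraMap_mem ⟨x, hx⟩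
      have hθE : θ ∈ E := IntermediateField.mem_adjoin_simple_self Fh θ
      have hrep : ∀ y ∈ E, ∃ h : Polynomial Ω, (∀ i, h.coeff i ∈ Fh) ∧ h.natDegree ≤ n ∧
          h.eval θ = y := by
        intro y hy
        have hy' : y ∈ (IntermediateField.adjoin Fh ({θ} : Set Ω)).toSubalgebra := hy
        rw [IntermediateField.adjoin_simple_toSubalgebra_of_isAlgebraic hθi.isAlgebraic,
          Algebra.adjoin_singleton_eq_range_aeval] at hy'
        obtain ⟨r, hr⟩ := (AlgHom.mem_range _).mp hy'
        refine ⟨(r %ₘ minpoly Fh θ).map (algebraMap Fh Ω), fun i => ?_, ?_, ?_⟩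
        · rw [coeff_map]
          exact ((r %ₘ minpoly Fh θ).coeff i).2
        · rw [natDegree_map]
          by_cases hr0 : r %ₘ minpoly Fh θ = 0
          · rw [hr0, natDegree_zero]
            exact Nat.zero_le _
          · have := natDegree_lt_natDegree hr0 (degree_modByMonic_lt r (minpoly.monic hθi))
            rw [hdeg'] at this
            exact Nat.lt_succ_iff.mp this
        · rw [eval_map, ← aeval_def, aeval_modByMonic_eq_self_of_root (minpoly.aeval Fh θ),
            hr]
      -- (C) immediacy of `E | Fh`
      have hv : ∀ y ∈ E, y ≠ 0 → ∃ u ∈ Fh, V.valuation y = V.valuation u := by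
        intro y hy hy0
        obtain ⟨h, hcoef, hdegh, rfl⟩ := hrep y hy
        have h0 : h ≠ 0 := by
          rintro rfl
          exact hy0 (eval_zero)
        obtain ⟨a, haF, hlt⟩ := hkey h h0 hcoef hdegh
        exact ⟨h.eval a, eval_mem_of_coeff_mem _ _ hcoef (hFFh haF), Valuation.map_eq_of_sub_lt _ hlt⟩
      have hr : resField V E ≤ resField V Fh := by
        intro ρ hρ
        change ρ ∈ (E.toSubring.comap V.subtype).map (IsLocalRing.residue V) at hρ
        change ρ ∈ (Fh.toSubring.comap V.subtype).map (IsLocalRing.residue V)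
        obtain ⟨y, hy, rfl⟩ := Subring.mem_map.mp hρ
        have hyE : (y : Ω) ∈ E := hy
        by_cases hy0 : (y : Ω) = 0
        · have : y = 0 := Subtype.ext hy0
          rw [this, map_zero]
          exact Subring.zero_mem _
        obtain ⟨h, hcoef, hdegh, hhy⟩ := hrep y hyE
        have h0 : h ≠ 0 := by
          rintro rfl
          exact hy0 (by rw [← hhy, eval_zero])
        obtain ⟨a, haF, hlt⟩ := hkey h h0 hcoef hdegh
        rw [hhy] at hlt
        have hcFh : h.eval a ∈ Fh := eval_mem_of_coeff_mem _ _ hcoef (hFFh haF)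
        have hvc : V.valuation (h.eval a) = V.valuation (y : Ω) :=
          (Valuation.map_eq_of_sub_lt _ hlt).symm
        have hcV : h.eval a ∈ V := by
          rw [← V.valuation_le_one_iff, hvc]
          exact (V.valuation_le_one_iff _).mpr y.2
        refine Subring.mem_map.mpr ⟨⟨h.eval a, hcV⟩, hcFh, ?_⟩
        refine (Ideal.Quotient.eq.mpr ?_).symm
        refine (V.valuation_lt_one_iff _).mpr ?_
        calc V.valuation (((y - ⟨h.eval a, hcV⟩ : V) : Ω)) = V.valuation ((y : Ω) - h.eval a) := rfl
          _ < V.valuation (h.eval a) := hlt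
          _ = V.valuation (y : Ω) := hvc
          _ ≤ 1 := (V.valuation_le_one_iff _).mpr y.2
      -- (D) the degree and the kill
      have hext : Subfield.extendScalars hFhE = IntermediateField.adjoin Fh ({θ} : Set Ω) :=
        IntermediateField.toSubfield_injective (by rw [Subfield.extendScalars_toSubfield])
      have hfr : Subfield.relfinrank Fh E = n + 1 := by
        rw [Subfield.relfinrank_eq_finrank_of_le hFhE, hext, IntermediateField.adjoin.finrank hθi,
          hdeg']
      have hEFh : E = Fh :=
        eq_of_isDefectlessField_of_immediate hFhE hhens hdefh (by rw [hfr]; exact Nat.succ_pos n)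
          hv hr
      have hθFh : θ ∈ Fh := hEFh ▸ hθE
      have hmin : minpoly Fh θ = X - C (⟨θ, hθFh⟩ : Fh) :=
        minpoly.eq_X_sub_C Ω (⟨θ, hθFh⟩ : Fh)
      have : (minpoly Fh θ).natDegree = 1 := by rw [hmin, natDegree_X_sub_C]
      rw [hdeg'] at this
      omega

/-- **Kaplansky's condition (3) over a rank-one defectless base** (ambient form): with the
hypotheses of `not_isPseudoLimit_of_isIntegral`, for every polynomial `g` over `F` the value
`v g(a)` is constant for `a ∈ F` close enough to `z`. [folklore] -/
theorem kaplansky_condition_of_isDefectlessField (hr1 : IsRankOneValued V F)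
    (hdef : IsDefectlessField F (V.comap (algebraMap F Ω))) {z : Ω} (hzF : z ∉ F)
    (hval : ∀ w ∈ Subfield.closure ((F : Set Ω) ∪ {z}), w ≠ 0 → ∃ b ∈ F,
      V.valuation w = V.valuation b)
    (hres : ∀ w ∈ Subfield.closure ((F : Set Ω) ∪ {z}), w ∈ V → ∃ c ∈ F,
      V.valuation (w - c) < 1)
    (hbd : ∃ b ∈ F, b ≠ 0 ∧ ∀ a ∈ F, V.valuation b ≤ V.valuation (z - a))
    {g : Polynomial Ω} (hg : ∀ i, g.coeff i ∈ F) :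
    ∃ a₀ ∈ F, ∃ α : V.ValueGroup, ∀ a ∈ F, V.valuation (z - a) ≤ V.valuation (z - a₀) →
      V.valuation (g.eval a) = α := by
  by_cases hg0 : g = 0
  · exact ⟨0, F.zero_mem, 0, fun a _ _ => by rw [hg0, eval_zero, map_zero]⟩
  have hint : ∀ θ ∈ g.roots, IsIntegral (henselization V F) θ := by
    intro θ hθ
    have hg' : ∀ i, g.coeff i ∈ henselization V F := fun i => le_henselization V F (hg i)
    exact (isIntegral_of_mem_roots_of_coeff_mem hg' hg0 hθ).1
  obtain ⟨a₀, ha₀, α, -, h⟩ := evConst_of_roots hzF hval hres hg0 fun θ hθ =>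
    not_isPseudoLimit_of_isIntegral hr1 hdef hzF hval hres hbd (hint θ hθ)
  exact ⟨a₀, ha₀, α, h⟩

end Main

end Summit.ResolutionOfSingularities.ResolutionOfSingularities.Theorems.DefectlessLadder
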